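import Mathlib
import Summits.CriticalPhenomena.CardyFormulaZ2.Theorems.CardyWhiteToColouredDriftBoundPlackettDefs
import Summits.CriticalPhenomena.CardyFormulaZ2.Theorems.CardyWhiteToColouredDriftBoundStubShortWayHalf
import Summits.CriticalPhenomena.CardyFormulaZ2.Theorems.CardyWhiteToColouredDriftBoundStubDriftIdentity
import Summits.CriticalPhenomena.CardyFormulaZ2.Theorems.CardyWhiteToColouredDriftBoundPairLaw
import Summits.CriticalPhenomena.CardyFormulaZ2.Theorems.CardyWhiteToColouredDriftBoundRegFlowPairLaw
import Summits.CriticalPhenomena.CardyFormulaZ2.Theorems.CardyWhiteToColouredNoiseDiscretisationDiscrepancy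

/-!
# The exact drift vanishes identically for the self-dual box: a kernel-checked instance of the
# symmetry cancellation behind the open pair estimate of line `registered`

Helper file for the crux item `stmt-CriticalPhenomena-4596`
(`Summit.CriticalPhenomena.CardyFormulaZ2.Theses.CardyWhiteToColoured.DriftBound`, route
`CardyWhiteToColoured` of `CardyFormulaZ2`), line `registered` (skeleton v4.1, lead c3), about its one
open stub `stub_pairEstimate` (smallness of the integrated Plackett/Piterbarg pair functional
`plackettDrift` for the crossing event of a conformal rectangle).

The route's mechanism for that smallness is a SYMMETRY CANCELLATION (quarter-turn∘duality of `ℤ²`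
acting on the medial set with the round kernel). In the one geometry where the symmetry is exact at
finite size — the `(n+1) × n` box `[0, n+1] × [0, n]` of bond-`ℤ²` duality — the cancellation can be
checked completely, and this file does so: for every width `σ > 0` and every regularisation `η > 0`,

  `plackettDrift I_n (LR([0,n+1]×[0,n])) η σ = 0`   (`plackettDrift_selfDualBox_eq_zero`),

where `I_n` are the lattice edges of the box. Proof: the pair law of the regularised normalised
configuration `{e | X̃^σ_e + η ζ_e > 0}` (independent `N(0,1)` noise `ζ_e` on every edge) is a
lattice-carried probability measure invariant under translations, the transposition and planar
duality (`pl_pairLaw_admissible`, p166793), so by `sw_real_lrRect_succ_self` (p156961) the box is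
crossed with probability exactly `1/2` at EVERY width; the regularised flow `regFlow I_n A η σ` is
that probability (`pl_regFlow_eq_pairLaw`, p166731, locality of rectangle crossings); hence the flow
is constant in `σ` and its exact derivative, the pair functional (`stub_driftIdentity`, p165365),
vanishes. For the `2:1` conformal rectangles of the crux no exact finite-size symmetry exists: the
open stub asks for the same cancellation asymptotically, with a summable remainder.

References: G. Grimmett, *Percolation* (1999), §11.2, Lemma 11.21; D. Beliaev, S. Muirhead, A. Rivera,
Ann. Probab. 48 (2020), Thm 2.14; L. Köhler-Schindler, V. Tassion, Duke Math. J. 172 (2023), §1.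
-/

noncomputable section

namespace Summit.CriticalPhenomena.CardyFormulaZ2.Cruxes.DriftBound.Birth

open Set Filter Topology MeasureTheory
open Literature.Probability.LatticeModels Literature.Probability.Percolation

/-- The closed box `[0, n+1] × [0, n] ⊂ ℂ` whose mesh-`1` inner edges are the edges of the
self-dual lattice rectangle `rect 0 (n+1) 0 n`. -/
theorem sdb_meshPoint_mem_iff (n : ℕ) (v : Site 2) :
    meshPoint 1 v ∈ {z : ℂ | 0 ≤ z.re ∧ z.re ≤ (n : ℝ) + 1 ∧ 0 ≤ z.im ∧ z.im ≤ (n : ℝ)} ↔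
      v ∈ KSTPeriodic.rect 0 ((n : ℤ) + 1) 0 n := by
  simp only [KSTPeriodic.rect, mem_setOf_eq, meshPoint_re, meshPoint_im, one_mul]
  constructor
  · rintro ⟨h1, h2, h3, h4⟩
    exact ⟨by exact_mod_cast h1, by exact_mod_cast h2, by exact_mod_cast h3, by exact_mod_cast h4⟩
  · rintro ⟨h1, h2, h3, h4⟩
    exact ⟨by exact_mod_cast h1, by exact_mod_cast h2, by exact_mod_cast h3, by exact_mod_cast h4⟩

/-- The box is bounded, so its inner edge set at mesh `1` is finite. -/
theorem sdb_innerEdgeSet_finite (n : ℕ) :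
    (innerEdgeSet {z : ℂ | 0 ≤ z.re ∧ z.re ≤ (n : ℝ) + 1 ∧ 0 ≤ z.im ∧ z.im ≤ (n : ℝ)} 1).Finite := by
  set Ω : Set ℂ := {z : ℂ | 0 ≤ z.re ∧ z.re ≤ (n : ℝ) + 1 ∧ 0 ≤ z.im ∧ z.im ≤ (n : ℝ)} with hΩ
  have hρ : (0 : ℝ) ≤ 2 * n + 2 := by positivity
  have hsub : Ω ⊆ Metric.closedBall (0 : ℂ) (2 * n + 2) := by
    intro z hz
    obtain ⟨h1, h2, h3, h4⟩ := hz
    rw [Metric.mem_closedBall, dist_zero_right]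
    calc ‖z‖ ≤ |z.re| + |z.im| := Complex.norm_le_abs_re_add_abs_im z
      _ ≤ (n + 1) + n := by rw [abs_of_nonneg h1, abs_of_nonneg h3]; exact add_le_add h2 h4
      _ = 2 * n + 1 := by ring
      _ ≤ 2 * n + 2 := by linarith
  obtain ⟨J, hJ, -⟩ :=
    Summit.CriticalPhenomena.CardyFormulaZ2.Theorems.WhiteToColoured.exists_finset_innerE_subset
      hρ hsub one_pos
  exact (Finset.finite_toSet J).subset hJ

/-- **The box event read on the box's own edges.** For every configuration `ω` carried by lattice
edges, `ω` crosses the box iff its trace on the inner edges of the box does (locality of rectangle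
crossings, `pl_regFlow_eq_pairLaw`, part (i)). -/
theorem sdb_mem_lrRect_iff_inter (n : ℕ) {ω : Set (Sym2 (Site 2))} (hω : ω ⊆ (zdGraph 2).edgeSet) :
    ω ∈ KSTPeriodic.lrRect 0 ((n : ℤ) + 1) 0 n ↔
      ω ∩ ↑(innerEdges {z : ℂ | 0 ≤ z.re ∧ z.re ≤ (n : ℝ) + 1 ∧ 0 ≤ z.im ∧ z.im ≤ (n : ℝ)} 1) ∈
        KSTPeriodic.lrRect 0 ((n : ℤ) + 1) 0 n := by
  refine pl_regFlow_eq_pairLaw.1 0 ((n : ℤ) + 1) 0 n ω _ fun e he => ?_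
  constructor
  · intro heω
    refine ⟨heω, ?_⟩
    rw [Finset.mem_coe, mem_innerEdges_iff_of_finite (sdb_innerEdgeSet_finite n)]
    exact ⟨hω heω, fun v hv => (sdb_meshPoint_mem_iff n v).2 (he v hv)⟩
  · exact fun h => h.1

/-- **The regularised flow of the self-dual box is identically `1/2`.** For every `n`, every width
`σ > 0` and every regularisation level `η`, the probability that the signs of `X̃^σ + η ζ` read on the
box's lattice edges cross the `(n+1) × n` box `[0, n+1] × [0, n]` from left to right is exactly
`1/2`: the pair law is admissible and self-dual (`pl_pairLaw_admissible`), so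
`sw_real_lrRect_succ_self` applies, and the regularised flow is that probability
(`pl_regFlow_eq_pairLaw`). -/
theorem regFlow_selfDualBox_eq_half (n : ℕ) {σ : ℝ} (hσ : 0 < σ) (η : ℝ) :
    regFlow (innerEdges {z : ℂ | 0 ≤ z.re ∧ z.re ≤ (n : ℝ) + 1 ∧ 0 ≤ z.im ∧ z.im ≤ (n : ℝ)} 1)
      (KSTPeriodic.lrRect 0 ((n : ℤ) + 1) 0 n) η σ = 1 / 2 := by
  set Ω : Set ℂ := {z : ℂ | 0 ≤ z.re ∧ z.re ≤ (n : ℝ) + 1 ∧ 0 ≤ z.im ∧ z.im ≤ (n : ℝ)} with hΩ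
  set I : Finset (Sym2 (Site 2)) := innerEdges Ω 1 with hI
  set A : Set (Set (Sym2 (Site 2))) := KSTPeriodic.lrRect 0 ((n : ℤ) + 1) 0 n with hA
  have hfin : (innerEdgeSet Ω 1).Finite := sdb_innerEdgeSet_finite n
  have hIE : (↑I : Set (Sym2 (Site 2))) ⊆ (zdGraph 2).edgeSet := by
    intro e he
    rw [Finset.mem_coe, hI, mem_innerEdges_iff_of_finite hfin] at he
    exact he.1
  -- the I-local version of the event
  set A' : Set (Set (Sym2 (Site 2))) := {ω | ω ∩ ↑I ∈ A} with hA'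
  have hA'meas : MeasurableSet A' := by
    have hm : Measurable fun ω : Set (Sym2 (Site 2)) => ω ∩ ↑I :=
      measurable_set_iff.2 fun e => (measurable_set_iff.1 measurable_id e).and measurable_const
    exact (KSTPeriodic.measurableSet_lrRect _ _ _ _).preimage hm
  have hA'loc : ∀ ω ω' : Set (Sym2 (Site 2)), ω ∩ ↑I = ω' ∩ ↑I → (ω ∈ A' ↔ ω' ∈ A') := by
    intro ω ω' h
    simp only [hA', mem_setOf_eq, h]
  -- `regIndicator` (hence `regFlow`) only sees configurations inside `I`
  have hreg : regIndicator I A' η = regIndicator I A η := by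
    funext x
    simp only [regIndicator, hA', mem_setOf_eq]
    congr 1
    ext ζ
    simp only [mem_setOf_eq]
    have hsub : {e : Sym2 (Site 2) | ∃ h : e ∈ I, 0 < x ⟨e, h⟩ + η * ζ ⟨e, h⟩} ∩ ↑I =
        {e : Sym2 (Site 2) | ∃ h : e ∈ I, 0 < x ⟨e, h⟩ + η * ζ ⟨e, h⟩} := by
      ext e
      simp only [mem_inter_iff, mem_setOf_eq, Finset.mem_coe]
      exact ⟨fun h => h.1, fun h => ⟨h, h.elim fun hp _ => hp⟩⟩
    rw [hsub]
  have hflowA : regFlow I A η σ = regFlow I A' η σ := by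
    simp only [regFlow, hreg]
  -- the pair law crosses the self-dual box with probability exactly `1/2`
  set cfg := fun p : ((zdGraph 2).edgeSet → ℝ) × ((zdGraph 2).edgeSet → ℝ) =>
    {e : Sym2 (Site 2) | ∃ h : e ∈ (zdGraph 2).edgeSet,
      0 < normNoise σ p.1 (medialPoint 1 e) + η * p.2 ⟨e, h⟩} with hcfg
  set M : Measure (Set (Sym2 (Site 2))) := (latticeWhiteNoise.prod latticeWhiteNoise).map cfg with hM
  obtain ⟨hprob, hL, hsh, htr, hdual⟩ := pl_pairLaw_admissible σ η hσ M hM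
  haveI := hprob
  have h1 : regFlow I A' η σ = M.real A' := pl_regFlow_eq_pairLaw.2 σ η I A' hσ hIE hA'meas hA'loc M hM
  have h2 : M.real A' = M.real A := by
    refine measureReal_congr ?_
    have hL' : ∀ᵐ ω ∂M, ω ⊆ (zdGraph 2).edgeSet := hL
    filter_upwards [hL'] with ω hω
    show (ω ∈ A') = (ω ∈ A)
    rw [eq_iff_iff]
    simp only [hA', mem_setOf_eq]
    exact (sdb_mem_lrRect_iff_inter n hω).symm
  have h3 : M.real A = 1 / 2 := sw_real_lrRect_succ_self hL hsh htr hdual n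
  rw [hflowA, h1, h2, h3]

/-- **The exact drift vanishes for the self-dual box.** For every `n`, every width `σ > 0` and every
regularisation `η > 0`, the Plackett/Piterbarg pair functional of the left–right crossing of the
`(n+1) × n` box `[0, n+1] × [0, n]`, read on the box's lattice edges, is `0`: the regularised flow
is identically `1/2` (`regFlow_selfDualBox_eq_half`) and the pair functional is its exact
`σ`-derivative (`stub_driftIdentity`). -/
theorem plackettDrift_selfDualBox_eq_zero (n : ℕ) {σ η : ℝ} (hσ : 0 < σ) (hη : 0 < η) :
    plackettDrift (innerEdges {z : ℂ | 0 ≤ z.re ∧ z.re ≤ (n : ℝ) + 1 ∧ 0 ≤ z.im ∧ z.im ≤ (n : ℝ)} 1)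
      (KSTPeriodic.lrRect 0 ((n : ℤ) + 1) 0 n) η σ = 0 := by
  have hderiv := stub_driftIdentity
    (innerEdges {z : ℂ | 0 ≤ z.re ∧ z.re ≤ (n : ℝ) + 1 ∧ 0 ≤ z.im ∧ z.im ≤ (n : ℝ)} 1)
    (KSTPeriodic.lrRect 0 ((n : ℤ) + 1) 0 n) η σ hη hσ
  have hconst : HasDerivAt (fun s : ℝ => regFlow
      (innerEdges {z : ℂ | 0 ≤ z.re ∧ z.re ≤ (n : ℝ) + 1 ∧ 0 ≤ z.im ∧ z.im ≤ (n : ℝ)} 1)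
      (KSTPeriodic.lrRect 0 ((n : ℤ) + 1) 0 n) η s) 0 σ := by
    refine (hasDerivAt_const σ (1 / 2 : ℝ)).congr_of_eventuallyEq ?_
    filter_upwards [Ioi_mem_nhds hσ] with s hs
    exact regFlow_selfDualBox_eq_half n hs η
  exact hderiv.unique hconst

/-- **The exact drift vanishes for the self-dual box (registered form).** For every `n`, `σ > 0`,
`η > 0`: the Plackett/Piterbarg pair functional of the crossing `LR([0, n+1] × [0, n])`, read on the
box's lattice edges at mesh `1`, is `0` — the symmetry cancellation behind the open pair estimate,
exact in the one exactly self-dual geometry. Fully qualified one-line statement registered as a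
sub-goal stub of the crux item. -/
theorem pl_plackettDrift_selfDualBox : ∀ (n : ℕ) (σ η : ℝ), 0 < σ → 0 < η → Summit.CriticalPhenomena.CardyFormulaZ2.Cruxes.DriftBound.Birth.plackettDrift (Summit.CriticalPhenomena.CardyFormulaZ2.Cruxes.DriftBound.Birth.innerEdges {z : ℂ | 0 ≤ z.re ∧ z.re ≤ (n : ℝ) + 1 ∧ 0 ≤ z.im ∧ z.im ≤ (n : ℝ)} 1) (Literature.Probability.Percolation.KSTPeriodic.lrRect 0 ((n : ℤ) + 1) 0 n) η σ = 0 :=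
  fun n _σ _η hσ hη => plackettDrift_selfDualBox_eq_zero n hσ hη

end Summit.CriticalPhenomena.CardyFormulaZ2.Cruxes.DriftBound.Birth

end
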